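import Literature.NumberTheory.Weil1964.LocalLerayCocycle
import HarnessLib

/-!
# The Leray cocycle and the Siegel parabolic `P_ℓ`: bi-`P_ℓ`-invariance, triviality on `P_ℓ`, `c(g, g⁻¹) = 1`

Topic `NumberTheory/Weil1964`; namespace `Literature.NumberTheory.Weil1964`. KERNEL mathematics only (theorems; no
named fact, no `axiom`, no `sorry`). Sequel of `LocalLerayCocycle.lean`: the formal properties of the multiplier
listed in [Rangarao1993, Thm 4.1 (1)–(2), Cor. 4.2] — which Rao derives for the Schrödinger multiplier and which, by
his Thm 4.1 (5) "`c(σ₁, σ₂)` = Weil index of … the Leray invariant", are identities of the Leray cocycle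
`c_ℓ(g₁, g₂) = μ_ψ(ℓ, g₁ℓ, g₁g₂ℓ)` — proved here DIRECTLY for `c_ℓ` over a non-archimedean local field, with
`P_ℓ = {p ∈ Sp(B) | pℓ = ℓ}` the stabiliser of the Lagrangian `ℓ` (hypotheses `ℓ.map p = ℓ`):
* `c_ℓ(p, g) = c_ℓ(g, p) = 1` for `p ∈ P_ℓ` (Thm 4.1 (2): "`c(σ₁, σ₂) = 1` if `σ₁, σ₂ ∈ P`", and more);
* **bi-`P_ℓ`-invariance** `c_ℓ(p₁ g₁ p, p⁻¹ g₂ p₂) = c_ℓ(g₁, g₂)` (Thm 4.1 (1)), from the three moves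
  `c(p g₁, g₂) = c(g₁, g₂)`, `c(g₁ p, g₂) = c(g₁, p g₂)`, `c(g₁, g₂ p) = c(g₁, g₂)`;
* `c_ℓ(g, g⁻¹) = c_ℓ(g⁻¹, g) = 1` (Cor. 4.2: "the isometry class `q(V*, V*σ, V*σ)` is the trivial class").

## References

* [Rangarao1993] R. Ranga Rao, *On some explicit formulas in the theory of Weil representation*, Pacific J. Math.
  157 (1993), Thm 4.1, Cor. 4.2, pp. 358–359.
* [MoeglinVignerasWaldspurger1987] C. Mœglin, M.-F. Vignéras, J.-L. Waldspurger, *Correspondances de Howe sur un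
  corps p-adique*, LNM 1291 (1987), Chap. 3 §I.3.
-/

set_option autoImplicit false

noncomputable section

open MeasureTheory
open Literature.LinearAlgebra.QuadraticForm

namespace Literature.NumberTheory.Weil1964

section Plumbing

variable {F : Type*} [Field F] {V : Type*} [AddCommGroup V] [Module F V]

/-- `(g h)ℓ = g(hℓ)` (plumbing). [folklore] -/
private theorem map_mul_eq'' (ℓ : Submodule F V) (g h : V ≃ₗ[F] V) :
    ℓ.map ((g * h : V ≃ₗ[F] V) : V →ₗ[F] V) = (ℓ.map (h : V →ₗ[F] V)).map (g : V →ₗ[F] V) := by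
  rw [LinearEquiv.coe_toLinearMap_mul, Module.End.mul_eq_comp, Submodule.map_comp]

/-- `g⁻¹(gℓ) = ℓ` (plumbing). [folklore] -/
private theorem map_inv_map (ℓ : Submodule F V) (g : V ≃ₗ[F] V) :
    (ℓ.map (g : V →ₗ[F] V)).map ((g⁻¹ : V ≃ₗ[F] V) : V →ₗ[F] V) = ℓ := by
  rw [← map_mul_eq'', inv_mul_cancel, LinearEquiv.coe_toLinearMap_one, Submodule.map_id]

/-- the inverse of an element of `P_ℓ` is in `P_ℓ` (plumbing). [folklore] -/
private theorem map_inv_eq_of_map_eq {ℓ : Submodule F V} {p : V ≃ₗ[F] V} (hp : ℓ.map (p : V →ₗ[F] V) = ℓ) :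
    ℓ.map ((p⁻¹ : V ≃ₗ[F] V) : V →ₗ[F] V) = ℓ := by
  have h := map_inv_map ℓ p
  rw [hp] at h
  exact h

end Plumbing

section Parabolic

variable {F : Type*} [Field F] [ValuativeRel F] [TopologicalSpace F] [IsNonarchimedeanLocalField F]
variable [MeasurableSpace F] [BorelSpace F] (μ : Measure F) [μ.IsAddHaarMeasure] {ψ : AddChar F Circle}
  [Invertible (2 : F)]
variable {V : Type*} [AddCommGroup V] [Module F V] [FiniteDimensional F V]

/-! ## Triviality against the stabiliser `P_ℓ` -/

/-- **`c_ℓ(p, g) = 1` for `pℓ = ℓ`** (`ℓ` isotropic, `g` arbitrary): `μ(ℓ, ℓ, pgℓ) = 1`.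
[cite: Rangarao1993, Thm 4.1 (2), p. 358] -/
theorem lerayCocycle_eq_one_of_map_eq_left (hψ : ψ.IsContinuousNontrivial) (B : LinearMap.BilinForm F V)
    {ℓ : Submodule F V} (hℓ : ∀ x ∈ ℓ, ∀ y ∈ ℓ, B x y = 0) {p : V ≃ₗ[F] V} (hp : ℓ.map (p : V →ₗ[F] V) = ℓ)
    (g : V ≃ₗ[F] V) : lerayCocycle ψ μ B ℓ p g = 1 := by
  rw [lerayCocycle_def, hp]
  exact lerayWeilIndex_self₁₂ μ hψ B hℓ _

/-- **`c_ℓ(g, p) = 1` for `pℓ = ℓ`** and `g` an isometry: `μ(ℓ, gℓ, gpℓ) = μ(ℓ, gℓ, gℓ) = 1`.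
[cite: Rangarao1993, Thm 4.1 (2), p. 358] -/
theorem lerayCocycle_eq_one_of_map_eq_right (hψ : ψ.IsContinuousNontrivial) (B : LinearMap.BilinForm F V)
    {ℓ : Submodule F V} (hℓ : ∀ x ∈ ℓ, ∀ y ∈ ℓ, B x y = 0) {g : V ≃ₗ[F] V} (hg : ∀ x y, B (g x) (g y) = B x y)
    {p : V ≃ₗ[F] V} (hp : ℓ.map (p : V →ₗ[F] V) = ℓ) : lerayCocycle ψ μ B ℓ g p = 1 := by
  rw [lerayCocycle_def, map_mul_eq'', hp]
  exact lerayWeilIndex_self₂₃ μ hψ B ℓ (isotropic_map hℓ g hg)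

/-- in particular `c_ℓ(p₁, p₂) = 1` on `P_ℓ × P_ℓ` ("`c(σ₁, σ₂) = 1` if `σ₁, σ₂ ∈ P`": the restriction of the
extension to `P_ℓ` is split by the trivial section). [cite: Rangarao1993, Thm 4.1 (2), p. 358] -/
theorem lerayCocycle_eq_one_of_map_eq (hψ : ψ.IsContinuousNontrivial) (B : LinearMap.BilinForm F V)
    {ℓ : Submodule F V} (hℓ : ∀ x ∈ ℓ, ∀ y ∈ ℓ, B x y = 0) {p₁ p₂ : V ≃ₗ[F] V}
    (hp₁ : ℓ.map (p₁ : V →ₗ[F] V) = ℓ) : lerayCocycle ψ μ B ℓ p₁ p₂ = 1 :=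
  lerayCocycle_eq_one_of_map_eq_left μ hψ B hℓ hp₁ p₂

/-! ## `c(g, g⁻¹) = 1` -/

/-- **[Rangarao1993, Cor. 4.2] for the Leray cocycle: `c_ℓ(g, g⁻¹) = 1`** (`μ(ℓ, gℓ, ℓ)` has a repeated plane).
[cite: Rangarao1993, Cor. 4.2, p. 359] -/
theorem lerayCocycle_mul_inv (hψ : ψ.IsContinuousNontrivial) (B : LinearMap.BilinForm F V) {ℓ : Submodule F V}
    (hℓ : ∀ x ∈ ℓ, ∀ y ∈ ℓ, B x y = 0) (g : V ≃ₗ[F] V) : lerayCocycle ψ μ B ℓ g g⁻¹ = 1 := by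
  rw [lerayCocycle_def, mul_inv_cancel, LinearEquiv.coe_toLinearMap_one, Submodule.map_id]
  exact lerayWeilIndex_self₃₁ μ hψ B _ hℓ

/-- `c_ℓ(g⁻¹, g) = 1`. [cite: Rangarao1993, Cor. 4.2, p. 359] -/
theorem lerayCocycle_inv_mul (hψ : ψ.IsContinuousNontrivial) (B : LinearMap.BilinForm F V) {ℓ : Submodule F V}
    (hℓ : ∀ x ∈ ℓ, ∀ y ∈ ℓ, B x y = 0) (g : V ≃ₗ[F] V) : lerayCocycle ψ μ B ℓ g⁻¹ g = 1 := by
  rw [lerayCocycle_def, inv_mul_cancel, LinearEquiv.coe_toLinearMap_one, Submodule.map_id]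
  exact lerayWeilIndex_self₃₁ μ hψ B _ hℓ

/-! ## Bi-`P_ℓ`-invariance ([Rangarao1993, Thm 4.1 (1)]) -/

/-- left move: **`c_ℓ(p g₁, g₂) = c_ℓ(g₁, g₂)`** for `p ∈ P_ℓ` an isometry (invariance of `μ` under `p`).
[cite: Rangarao1993, Thm 4.1 (1), p. 358] -/
theorem lerayCocycle_parabolic_mul_left (hψ : ψ.IsContinuousNontrivial) (B : LinearMap.BilinForm F V)
    (ℓ : Submodule F V) {p : V ≃ₗ[F] V} (hp : ℓ.map (p : V →ₗ[F] V) = ℓ) (hpB : ∀ x y, B (p x) (p y) = B x y)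
    (g₁ g₂ : V ≃ₗ[F] V) : lerayCocycle ψ μ B ℓ (p * g₁) g₂ = lerayCocycle ψ μ B ℓ g₁ g₂ := by
  rw [lerayCocycle_def, lerayCocycle_def, mul_assoc, map_mul_eq'' ℓ p g₁, map_mul_eq'' ℓ p (g₁ * g₂)]
  have h := lerayWeilIndex_map μ hψ B p hpB ℓ (ℓ.map (g₁ : V →ₗ[F] V)) (ℓ.map ((g₁ * g₂ : V ≃ₗ[F] V) : V →ₗ[F] V))
  rw [hp] at h
  exact h

omit [BorelSpace F] [μ.IsAddHaarMeasure] in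
/-- middle move: **`c_ℓ(g₁ p, g₂) = c_ℓ(g₁, p g₂)`** for `pℓ = ℓ`. [cite: Rangarao1993, Thm 4.1 (1), p. 358] -/
theorem lerayCocycle_mul_parabolic_left (B : LinearMap.BilinForm F V) (ℓ : Submodule F V) {p : V ≃ₗ[F] V}
    (hp : ℓ.map (p : V →ₗ[F] V) = ℓ) (g₁ g₂ : V ≃ₗ[F] V) :
    lerayCocycle ψ μ B ℓ (g₁ * p) g₂ = lerayCocycle ψ μ B ℓ g₁ (p * g₂) := by
  rw [lerayCocycle_def, lerayCocycle_def, map_mul_eq'' ℓ g₁ p, hp, mul_assoc]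

omit [BorelSpace F] [μ.IsAddHaarMeasure] in
/-- right move: **`c_ℓ(g₁, g₂ p) = c_ℓ(g₁, g₂)`** for `pℓ = ℓ`. [cite: Rangarao1993, Thm 4.1 (1), p. 358] -/
theorem lerayCocycle_mul_parabolic_right (B : LinearMap.BilinForm F V) (ℓ : Submodule F V) {p : V ≃ₗ[F] V}
    (hp : ℓ.map (p : V →ₗ[F] V) = ℓ) (g₁ g₂ : V ≃ₗ[F] V) :
    lerayCocycle ψ μ B ℓ g₁ (g₂ * p) = lerayCocycle ψ μ B ℓ g₁ g₂ := by
  rw [lerayCocycle_def, lerayCocycle_def, ← mul_assoc, map_mul_eq'' ℓ (g₁ * g₂) p, hp]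

/-- **[Rangarao1993, Thm 4.1 (1)] for the Leray cocycle — bi-`P_ℓ`-invariance**:
`c_ℓ(p₁ g₁ p, p⁻¹ g₂ p₂) = c_ℓ(g₁, g₂)` for `p, p₁, p₂ ∈ P_ℓ` (`p₁` an isometry), `g₁, g₂` arbitrary
("`c(p₁σ₁p, p⁻¹σ₂p₂) = c(σ₁, σ₂)` for all `p, p₁, p₂ ∈ P`"). [cite: Rangarao1993, Thm 4.1 (1), p. 358] -/
theorem lerayCocycle_parabolic_biinvariant (hψ : ψ.IsContinuousNontrivial) (B : LinearMap.BilinForm F V)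
    (ℓ : Submodule F V) {p p₁ p₂ : V ≃ₗ[F] V} (hp : ℓ.map (p : V →ₗ[F] V) = ℓ) (hp₁ : ℓ.map (p₁ : V →ₗ[F] V) = ℓ)
    (hp₁B : ∀ x y, B (p₁ x) (p₁ y) = B x y) (hp₂ : ℓ.map (p₂ : V →ₗ[F] V) = ℓ) (g₁ g₂ : V ≃ₗ[F] V) :
    lerayCocycle ψ μ B ℓ (p₁ * g₁ * p) (p⁻¹ * g₂ * p₂) = lerayCocycle ψ μ B ℓ g₁ g₂ := by
  rw [mul_assoc p₁, lerayCocycle_parabolic_mul_left μ hψ B ℓ hp₁ hp₁B, lerayCocycle_mul_parabolic_left μ B ℓ hp,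
    ← mul_assoc, ← mul_assoc, mul_inv_cancel, one_mul, lerayCocycle_mul_parabolic_right μ B ℓ hp₂]

omit [BorelSpace F] [μ.IsAddHaarMeasure] in
/-- the same moves through the MIDDLE only: `c_ℓ(g₁ p, p⁻¹ g₂) = c_ℓ(g₁, g₂)` for `pℓ = ℓ`.
[cite: Rangarao1993, Thm 4.1 (1), p. 358] -/
theorem lerayCocycle_mul_parabolic_inv (B : LinearMap.BilinForm F V) (ℓ : Submodule F V) {p : V ≃ₗ[F] V}
    (hp : ℓ.map (p : V →ₗ[F] V) = ℓ) (g₁ g₂ : V ≃ₗ[F] V) :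
    lerayCocycle ψ μ B ℓ (g₁ * p) (p⁻¹ * g₂) = lerayCocycle ψ μ B ℓ g₁ g₂ := by
  rw [lerayCocycle_mul_parabolic_left μ B ℓ hp, ← mul_assoc, mul_inv_cancel, one_mul]

/-- **conjugation-invariance under `P_ℓ`**: `c_ℓ(p g₁ p⁻¹, p g₂ p⁻¹) = c_ℓ(g₁, g₂)` for `p ∈ P_ℓ` an isometry.
[cite: Rangarao1993, Thm 4.1 (1), p. 358] -/
theorem lerayCocycle_conj_parabolic (hψ : ψ.IsContinuousNontrivial) (B : LinearMap.BilinForm F V)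
    (ℓ : Submodule F V) {p : V ≃ₗ[F] V} (hp : ℓ.map (p : V →ₗ[F] V) = ℓ) (hpB : ∀ x y, B (p x) (p y) = B x y)
    (g₁ g₂ : V ≃ₗ[F] V) :
    lerayCocycle ψ μ B ℓ (p * g₁ * p⁻¹) (p * g₂ * p⁻¹) = lerayCocycle ψ μ B ℓ g₁ g₂ := by
  have h := lerayCocycle_parabolic_biinvariant μ hψ B ℓ (p := p⁻¹) (p₁ := p) (p₂ := p⁻¹)
    (map_inv_eq_of_map_eq hp) hp hpB (map_inv_eq_of_map_eq hp) g₁ g₂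
  rwa [inv_inv] at h

end Parabolic

end Literature.NumberTheory.Weil1964
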